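import Summits.ResolutionOfSingularities.ResolutionOfSingularities.Theorems.PurelyInseparableDim4ResConeTransport
import Mathlib.RingTheory.MvPolynomial.IrreducibleQuadratic
import Mathlib.RingTheory.Polynomial.UniqueFactorization
import Mathlib.RingTheory.MvPowerSeries.Order
import Literature.AlgebraicGeometry.Resolution.OrdZeroBasics
import HarnessLib
import HarnessLib.Audit.Tags

/-!
# Purely inseparable four-folds — the LEDGER reads the vertex: `lin h ≡ c·ℓ (mod x_a)`, `c ≠ 0`
# (cell `res-dim4-pi`, K2(p) lane, slice B, brick (K9) «non-degeneracy / vanishing lemma for K4»)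

[OURS · counted 0 · cell `res-dim4-pi` · K2(p) lane holder res-dim4-p-12 g3's SLICE-B ARCHITECTURE
v1.1 (bus 23:13:42Z), brick (K9), seat res-dim4-p-11 g3; hand computation idea-4 g3 (bus 23:13Z).]
Nothing here proves K2(p) (`RidgeBudget.NoAboveFloorTrap p p`, slice B OPEN), `NoIsolatedTrap p p`
or resolution of singularities in dimension ≥ 4 / characteristic `p`.  AI kernel work, weaker than
expert review.

## What is proved (every field `K`, every `d ≥ 1`; no `d < p`, no characteristic hypothesis)

The slice-B LEDGER of a boundary letter `a` (ARCH v1.1) is the ideal membership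
`u · G ∈ (x_a, h^d)` with `u(0) ≠ 0`, `h(0) = 0`, for the residual polynomial `G` of order `d` whose
degree-`d` initial form `in_d G` is not divisible by `x_a`.  Reducing modulo `x_a` (the tree's
`PointBlowup.killVar a`) and comparing LOWEST homogeneous components in the domain `K[x₁..x₄]`:

* §1 kill-variable calculus: `x_a ↦ 0` commutes with homogeneous components, fixes the constant term,
  and kills exactly the multiples of `x_a` (`killVar_eq_zero_iff_X_dvd`); a linear form splits as its
  `x_a`-free part plus `η_a · x_a` (`eq_killVar_add_of_isHomogeneous_one`).
* §2 lowest components multiply (`homogeneousComponent_mul_of_le_ordZero`, Mathlib's power-series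
  statement read on polynomials) and `[h^k]_k = ([h]_1)^k` for `h(0) = 0`.
* §3 **(K9a, shape-free) `exists_killVar_homogeneousComponent_eq_C_mul_pow`**: the ledger forces
  `in_d G ≡ κ · (lin h)^d (mod x_a)` with `κ ≠ 0` — in particular the cone modulo `x_a` IS the `d`-th
  power of a linear form, and `lin h ≢ 0 (mod x_a)`.
* §4 `d`-th roots of `d`-th powers of linear forms (`K[x]` is a UFD, a non-zero linear form is prime):
  `exists_eq_C_mul_of_C_mul_pow_eq_C_mul_pow`.
* §5 **(K9) `exists_homogeneousComponent_one_eq_of_ledger`**: for a POWER CONE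
  `in_d G = a₀ · ℓ^d`, `lin h = c · ℓ + c′ · x_a` with `c ≠ 0` — the statement the holder asked for
  (K4 PERSIST: `lin h (v) = c · ℓ(v) + c′ · b_a`).

[cite: ZariskiSamuel1960, Vol. II Ch. VII §1 (order and initial form of a product of power series
over an integral domain: orders add, initial forms multiply)] [folklore]
bears_on: LADDER-RESOLUTION:D157-DOOR2 (res-dim4-pi · K2(p) · slice B · K9).  Supports
stmt-ResolutionOfSingularities-16155 (helper).
-/

set_option linter.dupNamespace false -- mandated namespace of this single-conjunct summit

noncomputable section

namespace Summit.ResolutionOfSingularities.ResolutionOfSingularities.Theorems.PIDim4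

namespace ResCone

open MvPolynomial Finset
open Literature.AlgebraicGeometry.Resolution
open Literature.AlgebraicGeometry.Resolution.Hauser2010

variable {K : Type} [Field K]

/-! ## 1. Kill-variable calculus -/

/-- `x_a ↦ 0` kills `x_a`. [folklore] -/
theorem killVar_X_self (a : Fin 4) : PointBlowup.killVar a (X a : MvPolynomial (Fin 4) K) = 0 := by
  unfold PointBlowup.killVar
  rw [aeval_X, if_pos rfl]

/-- `x_a ↦ 0` fixes the constant term. [folklore] -/
theorem constantCoeff_killVar (a : Fin 4) (P : MvPolynomial (Fin 4) K) :
    constantCoeff (PointBlowup.killVar a P) = constantCoeff P := by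
  rw [MvPolynomial.constantCoeff_eq, coeff_killVar, if_pos Finsupp.zero_apply]

/-- `x_a ↦ 0` commutes with taking homogeneous components. [folklore] -/
theorem homogeneousComponent_killVar (a : Fin 4) (n : ℕ) (P : MvPolynomial (Fin 4) K) :
    homogeneousComponent n (PointBlowup.killVar a P) = PointBlowup.killVar a (homogeneousComponent n P) := by
  ext γ
  rw [coeff_homogeneousComponent, coeff_killVar, coeff_killVar, coeff_homogeneousComponent]
  split_ifs <;> rfl

/-- `x_a ↦ 0` preserves homogeneity. [folklore] -/
theorem isHomogeneous_killVar (a : Fin 4) {P : MvPolynomial (Fin 4) K} {n : ℕ} (hP : P.IsHomogeneous n) :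
    (PointBlowup.killVar a P).IsHomogeneous n := by
  have h := homogeneousComponent_killVar a n P
  rw [homogeneousComponent_of_mem hP, if_pos rfl] at h
  rw [← h]
  exact homogeneousComponent_isHomogeneous n _

/-- `x_a ↦ 0` kills exactly the multiples of `x_a`. [folklore] -/
theorem killVar_eq_zero_iff_X_dvd (a : Fin 4) (P : MvPolynomial (Fin 4) K) :
    PointBlowup.killVar a P = 0 ↔ X a ∣ P := by
  constructor
  · intro h
    rw [X_dvd_iff_modMonomial_eq_zero]
    ext m
    rw [coeff_zero]
    by_cases hm : Finsupp.single a 1 ≤ m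
    · exact coeff_modMonomial_of_le _ hm
    · rw [coeff_modMonomial_of_not_le _ hm]
      have hma : m a = 0 := by
        by_contra hne
        exact hm (Finsupp.single_le_iff.mpr (Nat.one_le_iff_ne_zero.mpr hne))
      have hc := congrArg (coeff m) h
      rwa [coeff_killVar, if_pos hma, coeff_zero] at hc
  · rintro ⟨Q, rfl⟩
    rw [map_mul, killVar_X_self, zero_mul]

/-- Hence `P ∉ (x_a)` implies `P|_{x_a = 0} ≠ 0`. [folklore] -/
theorem killVar_ne_zero_of_notMem_span_X {a : Fin 4} {P : MvPolynomial (Fin 4) K}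
    (h : P ∉ Ideal.span {(X a : MvPolynomial (Fin 4) K)}) : PointBlowup.killVar a P ≠ 0 := by
  intro h0
  exact h (Ideal.mem_span_singleton.mpr ((killVar_eq_zero_iff_X_dvd a P).mp h0))

/-- An exponent of degree `1` with a non-zero `a`-entry is `e_a`. [folklore] -/
theorem eq_single_of_degree_eq_one {a : Fin 4} {m : Fin 4 →₀ ℕ} (hm : m.degree = 1) (hma : m a ≠ 0) :
    m = Finsupp.single a 1 := by
  have hle : Finsupp.single a 1 ≤ m := Finsupp.single_le_iff.mpr (Nat.one_le_iff_ne_zero.mpr hma)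
  obtain ⟨r, hr⟩ := exists_add_of_le hle
  have hdeg := congrArg Finsupp.degree hr
  rw [map_add, Finsupp.degree_single, hm] at hdeg
  have hr0 : r = 0 := (Finsupp.degree_eq_zero_iff r).mp (by omega)
  rw [hr, hr0, add_zero]

/-- **A linear form splits off its `x_a`-term**: `P = P|_{x_a = 0} + η_a · x_a` with
`η_a = coeff_{e_a} P`, for `P` homogeneous of degree `1`. [folklore] -/
theorem eq_killVar_add_of_isHomogeneous_one (a : Fin 4) {P : MvPolynomial (Fin 4) K}
    (hP : P.IsHomogeneous 1) :
    P = PointBlowup.killVar a P + C (coeff (Finsupp.single a 1) P) * X a := by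
  classical
  ext m
  rw [coeff_add, coeff_killVar, coeff_C_mul, coeff_X]
  by_cases hma : m a = 0
  · have hne : Finsupp.single a 1 ≠ m := by
      intro h; rw [← h, Finsupp.single_eq_same] at hma; exact one_ne_zero hma
    rw [if_pos hma, if_neg hne, mul_zero, add_zero]
  · rw [if_neg hma, zero_add]
    by_cases hm : Finsupp.single a 1 = m
    · rw [if_pos hm, mul_one, hm]
    · rw [if_neg hm, mul_zero]
      by_contra hc
      have hdeg : m.degree = 1 := by
        have h := hP hc
        rwa [weight_one_eq_degree] at h
      exact hm (eq_single_of_degree_eq_one hdeg hma).symm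

/-! ## 2. Lowest homogeneous components multiply -/

/-- The homogeneous components of a polynomial are those of its power series. [folklore] -/
theorem coe_homogeneousComponent (n : ℕ) (P : MvPolynomial (Fin 4) K) :
    ((homogeneousComponent n P : MvPolynomial (Fin 4) K) : MvPowerSeries (Fin 4) K) =
      MvPowerSeries.homogeneousComponent n (P : MvPowerSeries (Fin 4) K) := by
  ext d
  rw [MvPolynomial.coeff_coe, coeff_homogeneousComponent, MvPowerSeries.coeff_homogeneousComponent,
    MvPolynomial.coeff_coe]

/-- **Lowest components multiply**: if `m ≤ ord₀ P` and `n ≤ ord₀ Q` then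
`[P·Q]_{m+n} = [P]_m · [Q]_n` (Mathlib's `MvPowerSeries.homogeneousComponent_mul_of_le_order` read on
polynomials). [cite: ZariskiSamuel1960, Vol. II Ch. VII §1 (initial forms of power series multiply)] [folklore] -/
theorem homogeneousComponent_mul_of_le_ordZero {P Q : MvPolynomial (Fin 4) K} {m n : ℕ}
    (hP : (m : ℕ∞) ≤ ordZero P) (hQ : (n : ℕ∞) ≤ ordZero Q) :
    homogeneousComponent (m + n) (P * Q) = homogeneousComponent m P * homogeneousComponent n Q := by
  apply MvPolynomial.coe_injective
  rw [coe_homogeneousComponent, MvPolynomial.coe_mul, MvPolynomial.coe_mul, coe_homogeneousComponent,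
    coe_homogeneousComponent]
  exact MvPowerSeries.homogeneousComponent_mul_of_le_order hP hQ

/-- **Lowest component of a power**: `[h^k]_{k·n} = ([h]_n)^k` for `n ≤ ord₀ h`. [folklore] -/
theorem homogeneousComponent_pow_of_le_ordZero {h : MvPolynomial (Fin 4) K} {n : ℕ}
    (hh : (n : ℕ∞) ≤ ordZero h) (k : ℕ) :
    homogeneousComponent (k * n) (h ^ k) = homogeneousComponent n h ^ k := by
  induction k with
  | zero =>
    rw [zero_mul, pow_zero, pow_zero, homogeneousComponent_zero, ← MvPolynomial.constantCoeff_eq,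
      map_one, C_1]
  | succ k ih =>
    have hk : ((k * n : ℕ) : ℕ∞) ≤ ordZero (h ^ k) := by
      refine le_trans ?_ (le_ordZero_pow h k)
      push_cast
      exact mul_le_mul' le_rfl hh
    rw [Nat.succ_mul, pow_succ, pow_succ, homogeneousComponent_mul_of_le_ordZero hk hh, ih]

/-- The degree-`0` component is the constant term, read through `x_a ↦ 0`. [folklore] -/
theorem homogeneousComponent_zero_killVar (a : Fin 4) (P : MvPolynomial (Fin 4) K) :
    homogeneousComponent 0 (PointBlowup.killVar a P) = C (constantCoeff P) := by
  rw [homogeneousComponent_zero, ← constantCoeff_killVar a P, ← MvPolynomial.constantCoeff_eq]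

/-! ## 3. (K9a) The ledger forces the cone modulo `x_a` to be a `d`-th power of `lin h` -/

/-- If every component of `G` below `d` vanishes then so does every component of `G|_{x_a = 0}`:
`d ≤ ord₀ (G|_{x_a = 0})` for `ord₀ G = d`. [folklore] -/
theorem le_ordZero_killVar_of_ordZero_eq {a : Fin 4} {G : MvPolynomial (Fin 4) K} {d : ℕ}
    (hordG : ordZero G = d) : (d : ℕ∞) ≤ ordZero (PointBlowup.killVar a G) := by
  rw [natCast_le_ordZero_iff_forall_homogeneousComponent_eq_zero]
  intro m hm
  rw [homogeneousComponent_killVar, homogeneousComponent_eq_zero_of_lt_ordZero (P := G)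
    (by rw [hordG]; exact_mod_cast hm), map_zero]

/-- A polynomial without constant term has all its powers `h^d` of order `≥ d`. [folklore] -/
theorem le_ordZero_pow_of_constantCoeff_eq_zero {h : MvPolynomial (Fin 4) K} (hh : constantCoeff h = 0)
    (d : ℕ) : (d : ℕ∞) ≤ ordZero (h ^ d) := by
  rw [natCast_le_ordZero_iff_mem_idealOfVars_pow]
  exact Ideal.pow_mem_pow
    ((Literature.RingTheory.MvPolynomial.mem_idealOfVars_iff_constantCoeff_eq_zero h).mpr hh) d

/-- **(K9a) THE LEDGER READS THE CONE MODULO `x_a`, shape-free.**  If `u · G ∈ (x_a, h^d)` with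
`u(0) ≠ 0`, `h(0) = 0`, `ord₀ G = d ≥ 1` and `in_d G ∉ (x_a)`, then
`in_d G |_{x_a = 0} = κ · (lin h |_{x_a = 0})^d` for some `κ ≠ 0`: modulo `x_a` the cone is the `d`-th
power of the linear part of `h`, which is therefore non-zero modulo `x_a`.  (Reduce modulo `x_a`:
`ū Ḡ = T̄ h̄^d`; lowest components: `ord Ḡ = d`, `ord h̄ ≥ 1` give `u(0)·in_d Ḡ = T(0)·(lin h̄)^d`,
and the left side is non-zero.)  [OURS · K2(p) slice B (K9a)]
[cite: ZariskiSamuel1960, Vol. II Ch. VII §1] [folklore] -/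
theorem exists_killVar_homogeneousComponent_eq_C_mul_pow {a : Fin 4} {u G h : MvPolynomial (Fin 4) K}
    {d : ℕ} (hG : u * G ∈ Ideal.span {(X a : MvPolynomial (Fin 4) K), h ^ d})
    (hu : MvPolynomial.eval 0 u ≠ 0) (hh : h ∈ originIdeal K) (hordG : ordZero G = d)
    (hg : homogeneousComponent d G ∉ Ideal.span {(X a : MvPolynomial (Fin 4) K)}) :
    ∃ κ : K, κ ≠ 0 ∧ PointBlowup.killVar a (homogeneousComponent d G) =
      C κ * (PointBlowup.killVar a (homogeneousComponent 1 h)) ^ d := by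
  have hu0 : constantCoeff u ≠ 0 := by rwa [← MvPolynomial.eval_zero]
  have hh0 : constantCoeff h = 0 := (NarrowApolarity.mem_originIdeal_iff h).mp hh
  -- the membership, reduced modulo `x_a`
  obtain ⟨S, T, hST⟩ := Ideal.mem_span_pair.mp hG
  have hE : PointBlowup.killVar a T * PointBlowup.killVar a h ^ d =
      PointBlowup.killVar a u * PointBlowup.killVar a G := by
    have h := congrArg (PointBlowup.killVar a) hST
    rwa [map_add, map_mul, map_mul, map_mul, map_pow, killVar_X_self, mul_zero, zero_add] at h
  -- orders
  have hordG' : (d : ℕ∞) ≤ ordZero (PointBlowup.killVar a G) := le_ordZero_killVar_of_ordZero_eq hordG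
  have hh0' : constantCoeff (PointBlowup.killVar a h) = 0 := by rw [constantCoeff_killVar]; exact hh0
  have hordh' : ((1 : ℕ) : ℕ∞) ≤ ordZero (PointBlowup.killVar a h) := by
    rw [Nat.cast_one, one_le_ordZero_iff]
    exact hh0'
  have hordhd : (d : ℕ∞) ≤ ordZero (PointBlowup.killVar a h ^ d) :=
    le_ordZero_pow_of_constantCoeff_eq_zero hh0' d
  have h0u : ((0 : ℕ) : ℕ∞) ≤ ordZero (PointBlowup.killVar a u) := by simp
  have h0T : ((0 : ℕ) : ℕ∞) ≤ ordZero (PointBlowup.killVar a T) := by simp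
  -- lowest components of both sides of `hE`
  have hL : homogeneousComponent d (PointBlowup.killVar a u * PointBlowup.killVar a G) =
      C (constantCoeff u) * PointBlowup.killVar a (homogeneousComponent d G) := by
    have h := homogeneousComponent_mul_of_le_ordZero h0u hordG'
    rw [zero_add] at h
    rw [h, homogeneousComponent_zero_killVar, homogeneousComponent_killVar]
  have hR : homogeneousComponent d (PointBlowup.killVar a T * PointBlowup.killVar a h ^ d) =
      C (constantCoeff T) * PointBlowup.killVar a (homogeneousComponent 1 h) ^ d := by
    have h := homogeneousComponent_mul_of_le_ordZero h0T hordhd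
    rw [zero_add] at h
    have hpow := homogeneousComponent_pow_of_le_ordZero hordh' d
    rw [mul_one] at hpow
    rw [h, hpow, homogeneousComponent_zero_killVar, homogeneousComponent_killVar]
  have hkey : C (constantCoeff u) * PointBlowup.killVar a (homogeneousComponent d G) =
      C (constantCoeff T) * PointBlowup.killVar a (homogeneousComponent 1 h) ^ d := by
    rw [← hL, ← hR, hE]
  -- the left-hand side is non-zero, so `T(0) ≠ 0`; divide by `u(0)`
  have hg0 : PointBlowup.killVar a (homogeneousComponent d G) ≠ 0 := killVar_ne_zero_of_notMem_span_X hg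
  have hT0 : constantCoeff T ≠ 0 := by
    intro h0
    rw [h0, C_0, zero_mul, mul_eq_zero] at hkey
    rcases hkey with h1 | h1
    · exact hu0 ((C_eq_zero).mp h1)
    · exact hg0 h1
  refine ⟨(constantCoeff u)⁻¹ * constantCoeff T, mul_ne_zero (inv_ne_zero hu0) hT0, ?_⟩
  rw [C_mul, mul_assoc, ← hkey, ← mul_assoc, ← C_mul, inv_mul_cancel₀ hu0, C_1, one_mul]

/-! ## 4. `d`-th roots of `d`-th powers of linear forms -/

/-- A polynomial of total degree `1` over a field is irreducible, hence prime in the UFD `K[x]`.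
[folklore] -/
theorem prime_of_totalDegree_eq_one {L : MvPolynomial (Fin 4) K} (hL : L.totalDegree = 1) : Prime L := by
  refine (MvPolynomial.irreducible_of_totalDegree_eq_one hL fun x hx => ?_).prime
  -- some coefficient of `L` is non-zero, and `x` divides it
  have hL0 : L ≠ 0 := by rintro rfl; rw [totalDegree_zero] at hL; exact zero_ne_one hL
  obtain ⟨m, hm⟩ := MvPolynomial.ne_zero_iff.mp hL0
  obtain ⟨y, hy⟩ := hx m
  exact isUnit_iff_ne_zero.mpr fun h0 => hm (by rw [hy, h0, zero_mul])

/-- **`d`-th roots**: if `κ₁ · L^d = κ₂ · M^d` with `L` of total degree `1`, `M` of total degree `≤ 1`,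
`κ₁ ≠ 0` and `d ≥ 1`, then `M = c · L` for a scalar `c` (the prime `L` divides `M`, and degrees leave
room for a constant factor only). [folklore] -/
theorem exists_eq_C_mul_of_C_mul_pow_eq_C_mul_pow {L M : MvPolynomial (Fin 4) K} (hL : L.totalDegree = 1)
    (hM : M.totalDegree ≤ 1) {κ₁ κ₂ : K} (hκ₁ : κ₁ ≠ 0) {d : ℕ} (hd : 1 ≤ d)
    (h : C κ₁ * L ^ d = C κ₂ * M ^ d) : ∃ c : K, M = C c * L := by
  have hL0 : L ≠ 0 := by rintro rfl; rw [totalDegree_zero] at hL; exact zero_ne_one hL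
  have hprime := prime_of_totalDegree_eq_one hL
  by_cases hM0 : M = 0
  · exact ⟨0, by rw [hM0, C_0, zero_mul]⟩
  -- `L ∣ κ₂ · M^d`
  have hdvd : L ∣ C κ₂ * M ^ d := by
    rw [← h]
    exact (dvd_pow_self L (by omega)).mul_left _
  have hκ₂ : κ₂ ≠ 0 := by
    rintro rfl
    rw [C_0, zero_mul, mul_eq_zero] at h
    rcases h with h1 | h1
    · exact hκ₁ ((C_eq_zero).mp h1)
    · exact hL0 ((pow_eq_zero_iff (by omega)).mp h1)
  rcases hprime.dvd_or_dvd hdvd with h1 | h1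
  · -- `L ∣ C κ₂` is absurd by degrees
    have := totalDegree_le_of_dvd_of_isDomain h1 (by rw [Ne, C_eq_zero]; exact hκ₂)
    rw [hL, totalDegree_C] at this
    exact absurd this (by norm_num)
  · obtain ⟨A, hA⟩ := hprime.dvd_of_dvd_pow h1
    have hA0 : A ≠ 0 := by rintro rfl; exact hM0 (by rw [hA, mul_zero])
    have hdegA : A.totalDegree = 0 := by
      have := congrArg totalDegree hA
      rw [totalDegree_mul_of_isDomain hL0 hA0, hL] at this
      omega
    obtain ⟨c, hc⟩ : ∃ c, A = C c := ⟨_, (totalDegree_eq_zero_iff_eq_C (p := A)).mp hdegA⟩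
    exact ⟨c, by rw [hA, hc, mul_comm]⟩

/-! ## 5. (K9) For a power cone the ledger reads the vertex form: `lin h = c·ℓ + c′·x_a`, `c ≠ 0` -/

/-- Linear forms `Σ ℓᵢ xᵢ` are homogeneous of degree `1`. [folklore] -/
theorem isHomogeneous_linearForm (ℓ : Fin 4 → K) :
    (∑ i, C (ℓ i) * X i : MvPolynomial (Fin 4) K).IsHomogeneous 1 :=
  MvPolynomial.IsHomogeneous.sum _ _ _ fun _ _ => isHomogeneous_C_mul_X _ _

/-- The `e_a`-coefficient of `Σ ℓᵢ xᵢ` is `ℓ_a`. [folklore] -/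
theorem coeff_single_linearForm (ℓ : Fin 4 → K) (a : Fin 4) :
    coeff (Finsupp.single a 1) (∑ i, C (ℓ i) * X i : MvPolynomial (Fin 4) K) = ℓ a := by
  classical
  rw [coeff_sum, Finset.sum_eq_single a]
  · rw [coeff_C_mul, coeff_X, if_pos rfl, mul_one]
  · intro i _ hia
    rw [coeff_C_mul, coeff_X, if_neg (fun h => hia (Finsupp.single_left_injective one_ne_zero h)), mul_zero]
  · intro h; exact absurd (Finset.mem_univ a) h

/-- `(Σ ℓᵢ xᵢ)|_{x_a = 0} = Σ ℓᵢ xᵢ − ℓ_a x_a`. [folklore] -/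
theorem killVar_linearForm_eq_sub (a : Fin 4) (ℓ : Fin 4 → K) :
    PointBlowup.killVar a (∑ i, C (ℓ i) * X i : MvPolynomial (Fin 4) K) =
      (∑ i, C (ℓ i) * X i) - C (ℓ a) * X a := by
  have h := eq_killVar_add_of_isHomogeneous_one a (isHomogeneous_linearForm ℓ)
  rw [coeff_single_linearForm] at h
  exact eq_sub_of_add_eq h.symm

/-- **(K9) NON-DEGENERACY / VANISHING LEMMA for the ledger persistence (K4).**  If `u · G ∈ (x_a, h^d)`
with `u(0) ≠ 0`, `h(0) = 0`, `ord₀ G = d ≥ 1`, `in_d G ∉ (x_a)`, and the cone is a POWER CONE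
`in_d G = a₀ · (Σ ℓᵢ xᵢ)^d`, then the linear part of `h` is `c · (Σ ℓᵢ xᵢ) + c′ · x_a` with `c ≠ 0` —
so `lin h` evaluates on a step direction `v` to `c · ℓ(v) + c′ · v_a`.  [OURS · K2(p) slice B (K9),
statement of the lane holder res-dim4-p-12 g3 (ARCH v1.1); hand proof idea-4 g3]
[cite: ZariskiSamuel1960, Vol. II Ch. VII §1] [folklore] -/
theorem exists_homogeneousComponent_one_eq_of_ledger {a : Fin 4} {u G h : MvPolynomial (Fin 4) K}
    {d : ℕ} (hd : 1 ≤ d) (hG : u * G ∈ Ideal.span {(X a : MvPolynomial (Fin 4) K), h ^ d})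
    (hu : MvPolynomial.eval 0 u ≠ 0) (hh : h ∈ originIdeal K) (hordG : ordZero G = d)
    (hg : homogeneousComponent d G ∉ Ideal.span {(X a : MvPolynomial (Fin 4) K)})
    {a₀ : K} {ℓ : Fin 4 → K} (hcone : homogeneousComponent d G = C a₀ * (∑ i, C (ℓ i) * X i) ^ d) :
    ∃ c c' : K, c ≠ 0 ∧
      homogeneousComponent 1 h = C c * (∑ i, C (ℓ i) * X i) + C c' * X a := by
  classical
  obtain ⟨κ, -, hkey⟩ := exists_killVar_homogeneousComponent_eq_C_mul_pow hG hu hh hordG hg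
  -- the reduced cone is `a₀ · (L|_{x_a=0})^d`, non-zero
  have hg0 : PointBlowup.killVar a (homogeneousComponent d G) ≠ 0 := killVar_ne_zero_of_notMem_span_X hg
  have hkvC : PointBlowup.killVar a (C a₀ : MvPolynomial (Fin 4) K) = C a₀ := by
    rw [← MvPolynomial.algebraMap_eq]; exact (PointBlowup.killVar a).commutes a₀
  have hkvG : PointBlowup.killVar a (homogeneousComponent d G) =
      C a₀ * PointBlowup.killVar a (∑ i, C (ℓ i) * X i) ^ d := by
    rw [hcone, map_mul, map_pow, hkvC]
  have ha₀ : a₀ ≠ 0 := by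
    rintro rfl; exact hg0 (by rw [hkvG, C_0, zero_mul])
  have hkvL0 : PointBlowup.killVar a (∑ i, C (ℓ i) * X i : MvPolynomial (Fin 4) K) ≠ 0 := by
    intro h0; exact hg0 (by rw [hkvG, h0, zero_pow (by omega), mul_zero])
  -- degrees: both reduced linear forms are homogeneous of degree `1`
  have hLhom := isHomogeneous_killVar a (isHomogeneous_linearForm (K := K) ℓ)
  have hMhom := isHomogeneous_killVar a (homogeneousComponent_isHomogeneous (R := K) (σ := Fin 4) 1 h)
  have hdegL : (PointBlowup.killVar a (∑ i, C (ℓ i) * X i : MvPolynomial (Fin 4) K)).totalDegree = 1 :=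
    hLhom.totalDegree hkvL0
  have hdegM : (PointBlowup.killVar a (homogeneousComponent 1 h)).totalDegree ≤ 1 := by
    by_cases hM0 : PointBlowup.killVar a (homogeneousComponent 1 h) = 0
    · rw [hM0, totalDegree_zero]; exact zero_le_one
    · exact (hMhom.totalDegree hM0).le
  -- `d`-th root
  rw [hkvG] at hkey
  obtain ⟨c, hc⟩ := exists_eq_C_mul_of_C_mul_pow_eq_C_mul_pow hdegL hdegM ha₀ hd hkey
  have hc0 : c ≠ 0 := by
    rintro rfl
    rw [C_0, zero_mul] at hc
    rw [hc, zero_pow (by omega), mul_zero, mul_eq_zero] at hkey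
    rcases hkey with h1 | h1
    · exact ha₀ ((C_eq_zero).mp h1)
    · exact hkvL0 ((pow_eq_zero_iff (by omega)).mp h1)
  -- reassemble the `x_a`-terms
  refine ⟨c, coeff (Finsupp.single a 1) (homogeneousComponent 1 h) - c * ℓ a, hc0, ?_⟩
  calc homogeneousComponent 1 h
      = PointBlowup.killVar a (homogeneousComponent 1 h) +
          C (coeff (Finsupp.single a 1) (homogeneousComponent 1 h)) * X a :=
        eq_killVar_add_of_isHomogeneous_one a (homogeneousComponent_isHomogeneous 1 h)
    _ = C c * ((∑ i, C (ℓ i) * X i) - C (ℓ a) * X a) +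
          C (coeff (Finsupp.single a 1) (homogeneousComponent 1 h)) * X a := by
        rw [hc, killVar_linearForm_eq_sub]
    _ = C c * (∑ i, C (ℓ i) * X i) + C (coeff (Finsupp.single a 1) (homogeneousComponent 1 h) - c * ℓ a) * X a := by
        rw [map_sub, map_mul]; ring

end ResCone

end Summit.ResolutionOfSingularities.ResolutionOfSingularities.Theorems.PIDim4

end
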